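import Summits.CriticalPhenomena.PercolationContinuityZ3.Theorems.PercNearOneGluingNoHeavyLowerTailKnQuestion8CoefficientwiseComponentFlip
import HarnessLib

/-!
# The component cube of a CC colouring (THEOREM CC, part 2)

Support file (`--supports stmt-CriticalPhenomena-4575`, closed), prover `prim-lf-2` (gen 26).  No definitions, no named facts, no sorries; standard axioms.
Memo `prim-lf-2/CW-REDUCTION-gen26.md` §13.

For a CC colouring `s ⊆ E₀` (`K ∩ K̄ = {x}`, `K = C_x(s)`, `K̄ = C_x(E₀ \ s)`), let `U = K ∪ K̄` and let `Comps` be the finset of components of `U \ {x}`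
(clusters for the `E₀`-edges with both ends in `U \ {x}`, as sub-finsets of a vertex finset `Vf` containing all ends of `E₀`-edges), `T ⊆ Comps` the components
inside `K`.  All decidability is classical (as in part 1).  This file proves the bookkeeping behind THEOREM CC:
* components partition `U \ {x}` (`comps_cover`, `comps_eq_of_mem`, `comps_sub`, `comps_closed`, `comps_congr`);
* `K = {x} ∪ ⋃ T` and `K̄ = {x} ∪ ⋃ (Comps \ T)` (`openCluster_eq_biUnion_side`, `openCluster_sdiff_eq_biUnion_side`);
* for `J ⊆ Comps`, flipping the edges incident to `⋃ J` gives a CC colouring with the same `U` (hence the same components) and side set `T ∆ J`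
  (`flip_subset`, `sdiff_flip`, `flip_flip`, `union_flip_eq`, `cc_flip`, `side_flip_eq`).
[cite: KozmaNitzan2024, Questions 8–9 (§5.5 p. 36) (context: first rung of the coefficientwise programme for Question 8)]
-/

namespace Summit.CriticalPhenomena.PercolationContinuityZ3.Theorems

open Finset Literature.Probability.Percolation
open scoped symmDiff

namespace Coefficientwise

variable {ι V : Type*} (ends : ι → Sym2 V) (E₀ : Finset ι) (x : V) (Vf : Finset V)

set_option quotPrecheck false in
/-- red cluster of `x` -/
local notation "K[" s "]" => openCluster (ends '' (↑(s : Finset ι) : Set ι)) x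
set_option quotPrecheck false in
/-- `U = K ∪ K̄` -/
local notation "U[" s "]" => (openCluster (ends '' (↑(s : Finset ι) : Set ι)) x ∪ openCluster (ends '' (↑(E₀ \ s : Finset ι) : Set ι)) x)
set_option quotPrecheck false in
/-- the component of `v`: its cluster for the `E₀`-edges inside `U \ {x}` -/
local notation "Cmp[" s "," v "]" =>
  openCluster (ends '' (↑(E₀.filter (fun i => ∀ y ∈ ends i, y ∈ U[s] ∧ y ≠ x)) : Set ι)) v
set_option quotPrecheck false in
/-- the component of `v` as a finset -/
local notation "CmpF[" s "," v "]" => (Vf.filter (fun y : V => y ∈ Cmp[s, v]))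
set_option quotPrecheck false in
/-- the finset of components of `U \ {x}` -/
local notation "Comps[" s "]" => ((Vf.filter (fun v : V => v ∈ U[s] ∧ v ≠ x)).image (fun v : V => CmpF[s, v]))
set_option quotPrecheck false in
/-- the edges of `E₀` incident to a vertex set `W` -/
local notation "I[" W "]" => (E₀.filter (fun i => ∃ w, w ∈ (W : Set V) ∧ w ∈ ends i))

open Classical in
/-- Two vertices in the same component have the same component. [cite: KozmaNitzan2024, §5.5 (context only; folklore)] -/
theorem cmp_eq_of_mem {s : Finset ι} {v y : V} (hy : y ∈ Cmp[s, v]) : Cmp[s, y] = Cmp[s, v] := by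
  ext z
  change (openGraph _).Reachable y z ↔ (openGraph _).Reachable v z
  have hvy : (openGraph _).Reachable v y := hy
  exact ⟨fun h => hvy.trans h, fun h => hvy.symm.trans h⟩

open Classical in
/-- Every vertex of `U \ {x}` lies in its own component, which is one of the components. [cite: KozmaNitzan2024, §5.5 (context only; folklore)] -/
theorem comps_cover (hVf : ∀ i ∈ E₀, ∀ y ∈ ends i, y ∈ Vf) {s : Finset ι} (hs : s ⊆ E₀) {y : V} (hyU : y ∈ U[s]) (hyx : y ≠ x) :
    CmpF[s, y] ∈ Comps[s] ∧ y ∈ CmpF[s, y] := by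
  have hyV : y ∈ Vf := by
    rcases hyU with hy | hy
    · obtain ⟨i, hi, hyi⟩ := exists_edge_of_mem_openCluster ends hy hyx
      exact hVf i (hs hi) y hyi
    · obtain ⟨i, hi, hyi⟩ := exists_edge_of_mem_openCluster ends hy hyx
      exact hVf i (Finset.sdiff_subset hi) y hyi
  refine ⟨Finset.mem_image.mpr ⟨y, Finset.mem_filter.mpr ⟨hyV, hyU, hyx⟩, rfl⟩, ?_⟩
  rw [Finset.mem_filter]; exact ⟨hyV, mem_openCluster_self _ _⟩

open Classical in
/-- A component containing `y` is the component of `y`. [cite: KozmaNitzan2024, §5.5 (context only; folklore)] -/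
theorem comps_eq_of_mem {s : Finset ι} {C : Finset V} {y : V} (hC : C ∈ Comps[s]) (hy : y ∈ C) : C = CmpF[s, y] := by
  obtain ⟨v, _, hvC⟩ := Finset.mem_image.mp hC
  subst hvC
  rw [Finset.mem_filter] at hy
  ext z
  simp only [Finset.mem_filter]
  rw [cmp_eq_of_mem ends E₀ x hy.2]

open Classical in
/-- Components lie in `U \ {x}`. [cite: KozmaNitzan2024, §5.5 (context only; folklore)] -/
theorem comps_sub {s : Finset ι} {C : Finset V} {y : V} (hC : C ∈ Comps[s]) (hy : y ∈ C) : y ∈ U[s] ∧ y ≠ x := by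
  obtain ⟨v, hv, hvC⟩ := Finset.mem_image.mp hC
  subst hvC
  rw [Finset.mem_filter] at hv hy
  by_cases hyv : y = v
  · rw [hyv]; exact hv.2
  · obtain ⟨i, hi, hyi⟩ := exists_edge_of_mem_openCluster ends hy.2 hyv
    exact (Finset.mem_filter.mp hi).2 y hyi

open Classical in
/-- Components are closed under `E₀`-edges inside `U \ {x}`. [cite: KozmaNitzan2024, §5.5 (context only; folklore)] -/
theorem comps_closed (hVf : ∀ i ∈ E₀, ∀ y ∈ ends i, y ∈ Vf) {s : Finset ι} {C : Finset V} {y y' : V} {i : ι} (hC : C ∈ Comps[s]) (hy : y ∈ C)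
    (hi : i ∈ E₀) (he : ends i = s(y, y')) (hy'U : y' ∈ U[s]) (hy'x : y' ≠ x) : y' ∈ C := by
  have hyU := comps_sub ends E₀ x Vf hC hy
  obtain ⟨v, hv, hvC⟩ := Finset.mem_image.mp hC
  subst hvC
  rw [Finset.mem_filter] at hy ⊢
  refine ⟨hVf i hi y' (by rw [he]; exact Sym2.mem_mk_right y y'), ?_⟩
  have hiF : i ∈ E₀.filter (fun i => ∀ y ∈ ends i, y ∈ U[s] ∧ y ≠ x) := by
    rw [Finset.mem_filter]; refine ⟨hi, fun w hw => ?_⟩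
    rw [he, Sym2.mem_iff] at hw
    rcases hw with rfl | rfl
    · exact hyU
    · exact ⟨hy'U, hy'x⟩
  exact mem_openCluster_of_edge ends hiF he hy.2

open Classical in
/-- The components depend on the colouring only through `U`. [cite: KozmaNitzan2024, §5.5 (context only; folklore)] -/
theorem comps_congr {s s' : Finset ι} (hU : U[s'] = U[s]) : Comps[s'] = Comps[s] := by
  have hF : (E₀.filter (fun i => ∀ y ∈ ends i, y ∈ U[s'] ∧ y ≠ x)) = (E₀.filter (fun i => ∀ y ∈ ends i, y ∈ U[s] ∧ y ≠ x)) := by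
    ext i; simp only [Finset.mem_filter, hU]
  have h1 : (Vf.filter (fun v : V => v ∈ U[s'] ∧ v ≠ x)) = (Vf.filter (fun v : V => v ∈ U[s] ∧ v ≠ x)) := by
    ext v; simp only [Finset.mem_filter, hU]
  have h2 : (fun v : V => CmpF[s', v]) = (fun v : V => CmpF[s, v]) := by
    funext v; ext y; simp only [Finset.mem_filter, hF]
  rw [h1, h2]

open Classical in
/-- For a CC colouring, a component meeting the red cluster lies inside it. [cite: KozmaNitzan2024, §5.5 (context only; folklore)] -/
theorem comps_subset_red {s : Finset ι} (hCC : ∀ y, y ∈ K[s] → y ∈ K[E₀ \ s] → y = x) {C : Finset V} {y : V} (hC : C ∈ Comps[s]) (hy : y ∈ C)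
    (hyK : y ∈ K[s]) : (↑C : Set V) ⊆ K[s] := by
  intro z hz
  rw [Finset.mem_coe, comps_eq_of_mem ends E₀ x Vf hC hy, Finset.mem_filter] at hz
  exact (comp_subset_cluster ends hCC hyK (comps_sub ends E₀ x Vf hC hy).2 hz.2).1

open Classical in
/-- For a CC colouring, a component meeting the blue cluster lies inside it. [cite: KozmaNitzan2024, §5.5 (context only; folklore)] -/
theorem comps_subset_blue {s : Finset ι} (hCC : ∀ y, y ∈ K[s] → y ∈ K[E₀ \ s] → y = x) {C : Finset V} {y : V} (hC : C ∈ Comps[s])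
    (hy : y ∈ C) (hyKb : y ∈ K[E₀ \ s]) : (↑C : Set V) ⊆ K[E₀ \ s] := by
  intro z hz
  rw [Finset.mem_coe, comps_eq_of_mem ends E₀ x Vf hC hy, Finset.mem_filter] at hz
  have hyx := (comps_sub ends E₀ x Vf hC hy).2
  -- walk inside the component from `y`: blue membership propagates (a red step back would make the previous vertex doubly reached)
  obtain ⟨-, hz'⟩ := hz
  change (openGraph _).Reachable y z at hz'
  rw [SimpleGraph.reachable_iff_reflTransGen] at hz'
  suffices h : z ∈ K[E₀ \ s] ∧ z ≠ x from h.1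
  induction hz' with
  | refl => exact ⟨hyKb, hyx⟩
  | @tail b c _ hbc ih =>
    obtain ⟨hbKb, hbx⟩ := ih
    rw [openGraph_image_adj] at hbc
    obtain ⟨⟨i, hiF, hi⟩, _⟩ := hbc
    rw [Finset.mem_filter] at hiF
    obtain ⟨hiE, hends⟩ := hiF
    obtain ⟨hcU, hcx⟩ := hends c (by rw [hi]; exact Sym2.mem_mk_right b c)
    refine ⟨?_, hcx⟩
    by_cases his : i ∈ s
    · rcases hcU with hcK | hcKb
      · have hbK : b ∈ K[s] := mem_openCluster_of_edge ends his (hi.trans Sym2.eq_swap) hcK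
        exact absurd (hCC b hbK hbKb) hbx
      · exact hcKb
    · exact mem_openCluster_of_edge ends (Finset.mem_sdiff.mpr ⟨hiE, his⟩) hi hbKb

open Classical in
/-- `K = {x} ∪ ⋃ T`, `T` = the components inside `K`. [cite: KozmaNitzan2024, §5.5 (context only; folklore)] -/
theorem openCluster_eq_biUnion_side (hVf : ∀ i ∈ E₀, ∀ y ∈ ends i, y ∈ Vf) {s : Finset ι} (hs : s ⊆ E₀) (hCC : ∀ y, y ∈ K[s] → y ∈ K[E₀ \ s] → y = x) :
    K[s] = ↑(insert x (((Comps[s]).filter (fun C : Finset V => (↑C : Set V) ⊆ K[s])).biUnion id)) := by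
  ext z
  rw [Finset.coe_insert, Set.mem_insert_iff, Finset.mem_coe, Finset.mem_biUnion]
  constructor
  · intro hz
    by_cases hzx : z = x
    · exact Or.inl hzx
    · obtain ⟨hC, hzC⟩ := comps_cover ends E₀ x Vf hVf hs (Or.inl hz) hzx
      exact Or.inr ⟨_, Finset.mem_filter.mpr ⟨hC, comps_subset_red ends E₀ x Vf hCC hC hzC hz⟩, hzC⟩
  · rintro (rfl | ⟨C, hC, hzC⟩)
    · exact mem_openCluster_self _ _
    · exact (Finset.mem_filter.mp hC).2 hzC

open Classical in
/-- `K̄ = {x} ∪ ⋃ (Comps \ T)`. [cite: KozmaNitzan2024, §5.5 (context only; folklore)] -/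
theorem openCluster_sdiff_eq_biUnion_side (hVf : ∀ i ∈ E₀, ∀ y ∈ ends i, y ∈ Vf) {s : Finset ι} (hs : s ⊆ E₀) (hCC : ∀ y, y ∈ K[s] → y ∈ K[E₀ \ s] → y = x) :
    K[E₀ \ s] = ↑(insert x ((Comps[s] \ (Comps[s]).filter (fun C : Finset V => (↑C : Set V) ⊆ K[s])).biUnion id)) := by
  ext z
  rw [Finset.coe_insert, Set.mem_insert_iff, Finset.mem_coe, Finset.mem_biUnion]
  constructor
  · intro hz
    by_cases hzx : z = x
    · exact Or.inl hzx
    · obtain ⟨hC, hzC⟩ := comps_cover ends E₀ x Vf hVf hs (Or.inr hz) hzx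
      refine Or.inr ⟨_, Finset.mem_sdiff.mpr ⟨hC, fun hT => hzx ?_⟩, hzC⟩
      exact hCC z ((Finset.mem_filter.mp hT).2 hzC) hz
  · rintro (rfl | ⟨C, hC, hzC⟩)
    · exact mem_openCluster_self _ _
    · rw [Finset.mem_sdiff] at hC
      obtain ⟨hyU, -⟩ := comps_sub ends E₀ x Vf hC.1 hzC
      rcases hyU with hzK | hzKb
      · exact absurd (Finset.mem_filter.mpr ⟨hC.1, comps_subset_red ends E₀ x Vf hCC hC.1 hzC hzK⟩) hC.2
      · exact hzKb

open Classical in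
/-- A component lies inside `⋃ J` iff it belongs to `J` (for `J ⊆ Comps`). [cite: KozmaNitzan2024, §5.5 (context only; folklore)] -/
theorem comps_subset_biUnion_iff {s : Finset ι} {J : Finset (Finset V)} (hJ : J ⊆ Comps[s]) {C : Finset V} (hC : C ∈ Comps[s]) :
    (↑C : Set V) ⊆ ↑(J.biUnion id) ↔ C ∈ J := by
  constructor
  · intro h
    obtain ⟨v, hv, hvC⟩ := Finset.mem_image.mp hC
    have hvC' : v ∈ C := by rw [← hvC, Finset.mem_filter]; exact ⟨(Finset.mem_filter.mp hv).1, mem_openCluster_self _ _⟩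
    have := h hvC'
    rw [Finset.mem_coe, Finset.mem_biUnion] at this
    obtain ⟨C', hC', hvC''⟩ := this
    have h1 := comps_eq_of_mem ends E₀ x Vf hC hvC'
    have h2 := comps_eq_of_mem ends E₀ x Vf (hJ hC') hvC''
    rw [h1, ← h2]; exact hC'
  · intro h z hz
    rw [Finset.mem_coe, Finset.mem_biUnion]; exact ⟨C, h, hz⟩

open Classical in
/-- A component not in `J` is disjoint from `⋃ J`. [cite: KozmaNitzan2024, §5.5 (context only; folklore)] -/
theorem comps_not_mem_biUnion {s : Finset ι} {J : Finset (Finset V)} (hJ : J ⊆ Comps[s]) {C : Finset V} (hC : C ∈ Comps[s]) (hCJ : C ∉ J)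
    {z : V} (hz : z ∈ C) : z ∉ (↑(J.biUnion id) : Set V) := by
  intro h
  rw [Finset.mem_coe, Finset.mem_biUnion] at h
  obtain ⟨C', hC', hzC'⟩ := h
  have h1 := comps_eq_of_mem ends E₀ x Vf hC hz
  have h2 := comps_eq_of_mem ends E₀ x Vf (hJ hC') hzC'
  rw [h1, ← h2] at hCJ
  exact hCJ hC'

open Classical in
/-- `⋃ J` lies in `U \ {x}` and is closed (the hypotheses of the FLIP LEMMA). [cite: KozmaNitzan2024, §5.5 (context only; folklore)] -/
theorem biUnion_comps_closed (hVf : ∀ i ∈ E₀, ∀ y ∈ ends i, y ∈ Vf) {s : Finset ι} {J : Finset (Finset V)} (hJ : J ⊆ Comps[s]) (W : Set V) (hW : W = ↑(J.biUnion id)) :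
    (∀ w ∈ W, (w ∈ K[s] ∨ w ∈ K[E₀ \ s]) ∧ w ≠ x) ∧
    (∀ w ∈ W, ∀ i ∈ E₀, ∀ w', ends i = s(w, w') → (w' ∈ K[s] ∨ w' ∈ K[E₀ \ s]) → w' ≠ x → w' ∈ W) := by
  subst hW
  constructor
  · intro w hw
    rw [Finset.mem_coe, Finset.mem_biUnion] at hw
    obtain ⟨C, hC, hwC⟩ := hw
    exact comps_sub ends E₀ x Vf (hJ hC) hwC
  · intro w hw i hi w' he hw'U hw'x
    rw [Finset.mem_coe, Finset.mem_biUnion] at hw ⊢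
    obtain ⟨C, hC, hwC⟩ := hw
    exact ⟨C, hC, comps_closed ends E₀ x Vf hVf (hJ hC) hwC hi he hw'U hw'x⟩

open Classical in
/-- The flipped colouring stays inside `E₀`. [cite: KozmaNitzan2024, §5.5 (context only; folklore)] -/
theorem flip_subset {s : Finset ι} (hs : s ⊆ E₀) (W : Set V) : s ∆ I[W] ⊆ E₀ := by
  intro i hi
  rw [Finset.mem_symmDiff] at hi
  rcases hi with ⟨his, -⟩ | ⟨hiI, -⟩
  · exact hs his
  · exact (Finset.mem_filter.mp hiI).1

open Classical in
/-- The blue edges of the flipped colouring are the flipped blue edges. [cite: KozmaNitzan2024, §5.5 (context only; folklore)] -/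
theorem sdiff_flip {s : Finset ι} (hs : s ⊆ E₀) (W : Set V) : E₀ \ (s ∆ I[W]) = (E₀ \ s) ∆ I[W] := by
  ext i
  rw [Finset.mem_sdiff, Finset.mem_symmDiff, Finset.mem_symmDiff, Finset.mem_sdiff]
  have hI : i ∈ I[W] → i ∈ E₀ := fun h => (Finset.mem_filter.mp h).1
  have hsE : i ∈ s → i ∈ E₀ := fun h => hs h
  constructor
  · rintro ⟨hiE, hn⟩
    by_cases his : i ∈ s
    · by_cases hiI : i ∈ I[W]
      · exact Or.inr ⟨hiI, fun h => h.2 his⟩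
      · exact absurd (Or.inl ⟨his, hiI⟩) hn
    · by_cases hiI : i ∈ I[W]
      · exact absurd (Or.inr ⟨hiI, his⟩) hn
      · exact Or.inl ⟨⟨hiE, his⟩, hiI⟩
  · rintro (⟨⟨hiE, his⟩, hiI⟩ | ⟨hiI, hn⟩)
    · refine ⟨hiE, ?_⟩
      rintro (⟨his', -⟩ | ⟨hiI', -⟩)
      · exact his his'
      · exact hiI hiI'
    · refine ⟨hI hiI, ?_⟩
      rintro (⟨his', hiI'⟩ | ⟨-, his'⟩)
      · exact hiI' hiI
      · exact hn ⟨hI hiI, his'⟩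

open Classical in
/-- Flipping twice restores the colouring. [cite: KozmaNitzan2024, §5.5 (context only; folklore)] -/
theorem flip_flip (s : Finset ι) (W : Set V) : (s ∆ I[W]) ∆ I[W] = s := symmDiff_symmDiff_cancel_right _ _

open Classical in
/-- FLIP keeps `U = K ∪ K̄`. [cite: KozmaNitzan2024, §5.5 (context only; folklore)] -/
theorem union_flip_eq (hVf : ∀ i ∈ E₀, ∀ y ∈ ends i, y ∈ Vf) {s : Finset ι} (hs : s ⊆ E₀) (hCC : ∀ y, y ∈ K[s] → y ∈ K[E₀ \ s] → y = x) {J : Finset (Finset V)}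
    (hJ : J ⊆ Comps[s]) (W : Set V) (hW : W = ↑(J.biUnion id)) : U[s ∆ I[W]] = U[s] := by
  obtain ⟨hWU, hWc⟩ := biUnion_comps_closed ends E₀ x Vf hVf hJ W hW
  have hCC' : ∀ y', y' ∈ K[E₀ \ s] → y' ∈ K[E₀ \ (E₀ \ s)] → y' = x := by
    intro y' h1 h2; rw [Finset.sdiff_sdiff_eq_self hs] at h2; exact hCC y' h2 h1
  have hWU' : ∀ w ∈ W, (w ∈ K[E₀ \ s] ∨ w ∈ K[E₀ \ (E₀ \ s)]) ∧ w ≠ x := by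
    intro w hw; rw [Finset.sdiff_sdiff_eq_self hs]; exact ⟨(hWU w hw).1.symm, (hWU w hw).2⟩
  have hWc' : ∀ w ∈ W, ∀ i ∈ E₀, ∀ w', ends i = s(w, w') → (w' ∈ K[E₀ \ s] ∨ w' ∈ K[E₀ \ (E₀ \ s)]) → w' ≠ x → w' ∈ W := by
    intro w hw i hi w' he hU hx; rw [Finset.sdiff_sdiff_eq_self hs] at hU; exact hWc w hw i hi w' he hU.symm hx
  have hred := mem_openCluster_flip_iff ends hs hCC W hWU hWc
  have hblue := mem_openCluster_flip_iff ends (Finset.sdiff_subset (s := E₀) (t := s)) hCC' W hWU' hWc'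
  ext z
  rw [sdiff_flip ends E₀ hs W, Set.mem_union, Set.mem_union, hred z, hblue z, Finset.sdiff_sdiff_eq_self hs]
  constructor
  · rintro ((rfl | ⟨h, -⟩ | ⟨-, h⟩) | (rfl | ⟨h, -⟩ | ⟨-, h⟩))
    · exact Or.inl (mem_openCluster_self _ _)
    · exact Or.inl h
    · exact Or.inr h
    · exact Or.inl (mem_openCluster_self _ _)
    · exact Or.inr h
    · exact Or.inl h
  · rintro (h | h)
    · by_cases hzW : z ∈ W
      · exact Or.inr (Or.inr (Or.inr ⟨hzW, h⟩))
      · exact Or.inl (Or.inr (Or.inl ⟨h, hzW⟩))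
    · by_cases hzW : z ∈ W
      · exact Or.inl (Or.inr (Or.inr ⟨hzW, h⟩))
      · exact Or.inr (Or.inr (Or.inl ⟨h, hzW⟩))

open Classical in
/-- FLIP keeps the colouring CC. [cite: KozmaNitzan2024, §5.5 (context only; folklore)] -/
theorem cc_flip (hVf : ∀ i ∈ E₀, ∀ y ∈ ends i, y ∈ Vf) {s : Finset ι} (hs : s ⊆ E₀) (hCC : ∀ y, y ∈ K[s] → y ∈ K[E₀ \ s] → y = x) {J : Finset (Finset V)}
    (hJ : J ⊆ Comps[s]) (W : Set V) (hW : W = ↑(J.biUnion id)) : ∀ y, y ∈ K[s ∆ I[W]] → y ∈ K[E₀ \ (s ∆ I[W])] → y = x := by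
  obtain ⟨hWU, hWc⟩ := biUnion_comps_closed ends E₀ x Vf hVf hJ W hW
  have hCC' : ∀ y', y' ∈ K[E₀ \ s] → y' ∈ K[E₀ \ (E₀ \ s)] → y' = x := by
    intro y' h1 h2; rw [Finset.sdiff_sdiff_eq_self hs] at h2; exact hCC y' h2 h1
  have hWU' : ∀ w ∈ W, (w ∈ K[E₀ \ s] ∨ w ∈ K[E₀ \ (E₀ \ s)]) ∧ w ≠ x := by
    intro w hw; rw [Finset.sdiff_sdiff_eq_self hs]; exact ⟨(hWU w hw).1.symm, (hWU w hw).2⟩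
  have hWc' : ∀ w ∈ W, ∀ i ∈ E₀, ∀ w', ends i = s(w, w') → (w' ∈ K[E₀ \ s] ∨ w' ∈ K[E₀ \ (E₀ \ s)]) → w' ≠ x → w' ∈ W := by
    intro w hw i hi w' he hU hx; rw [Finset.sdiff_sdiff_eq_self hs] at hU; exact hWc w hw i hi w' he hU.symm hx
  have hred := mem_openCluster_flip_iff ends hs hCC W hWU hWc
  have hblue := mem_openCluster_flip_iff ends (Finset.sdiff_subset (s := E₀) (t := s)) hCC' W hWU' hWc'
  intro y h1 h2
  rw [sdiff_flip ends E₀ hs W, hblue y, Finset.sdiff_sdiff_eq_self hs] at h2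
  rw [hred y] at h1
  rcases h1 with rfl | ⟨hyK, hyW⟩ | ⟨hyW, hyKb⟩
  · rfl
  · rcases h2 with rfl | ⟨hyKb, -⟩ | ⟨hyW', -⟩
    · rfl
    · exact hCC y hyK hyKb
    · exact absurd hyW' hyW
  · rcases h2 with rfl | ⟨-, hyW'⟩ | ⟨-, hyK⟩
    · rfl
    · exact absurd hyW hyW'
    · exact hCC y hyK hyKb

open Classical in
/-- FLIP by `J ⊆ Comps` changes the side set `T` (components inside `K`) to `T ∆ J`. [cite: KozmaNitzan2024, §5.5 (context only; folklore)] -/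
theorem side_flip_eq (hVf : ∀ i ∈ E₀, ∀ y ∈ ends i, y ∈ Vf) {s : Finset ι} (hs : s ⊆ E₀) (hCC : ∀ y, y ∈ K[s] → y ∈ K[E₀ \ s] → y = x) {J : Finset (Finset V)}
    (hJ : J ⊆ Comps[s]) (W : Set V) (hW : W = ↑(J.biUnion id)) :
    (Comps[s ∆ I[W]]).filter (fun C : Finset V => (↑C : Set V) ⊆ K[s ∆ I[W]]) =
      ((Comps[s]).filter (fun C : Finset V => (↑C : Set V) ⊆ K[s])) ∆ J := by
  obtain ⟨hWU, hWc⟩ := biUnion_comps_closed ends E₀ x Vf hVf hJ W hW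
  have hred := mem_openCluster_flip_iff ends hs hCC W hWU hWc
  rw [comps_congr ends E₀ x Vf (union_flip_eq ends E₀ x Vf hVf hs hCC hJ W hW)]
  ext C
  rw [Finset.mem_filter, Finset.mem_symmDiff, Finset.mem_filter]
  constructor
  · rintro ⟨hC, hsub⟩
    obtain ⟨v, hv, hvC⟩ := Finset.mem_image.mp hC
    have hvC' : v ∈ C := by rw [← hvC, Finset.mem_filter]; exact ⟨(Finset.mem_filter.mp hv).1, mem_openCluster_self _ _⟩
    have hv' := hsub hvC'
    rw [hred v] at hv'
    rw [Finset.mem_filter] at hv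
    rcases hv' with hvx | ⟨hvK, hvW⟩ | ⟨hvW, hvKb⟩
    · exact absurd hvx hv.2.2
    · left
      refine ⟨⟨hC, comps_subset_red ends E₀ x Vf hCC hC hvC' hvK⟩, fun hCJ => hvW ?_⟩
      rw [hW, Finset.mem_coe, Finset.mem_biUnion]; exact ⟨_, hCJ, hvC'⟩
    · right
      refine ⟨?_, fun ⟨_, hsubK⟩ => hv.2.2 (hCC v (hsubK hvC') hvKb)⟩
      by_contra hCJ
      exact comps_not_mem_biUnion ends E₀ x Vf hJ hC hCJ hvC' (hW ▸ hvW)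
  · rintro (⟨⟨hC, hsubK⟩, hCJ⟩ | ⟨hCJ, hnot⟩)
    · refine ⟨hC, fun z hz => ?_⟩
      rw [Finset.mem_coe] at hz
      rw [hred z]
      exact Or.inr (Or.inl ⟨hsubK hz, hW ▸ comps_not_mem_biUnion ends E₀ x Vf hJ hC hCJ hz⟩)
    · have hC : C ∈ Comps[s] := hJ hCJ
      refine ⟨hC, fun z hz => ?_⟩
      rw [Finset.mem_coe] at hz
      rw [hred z]
      have hzW : z ∈ W := by rw [hW, Finset.mem_coe, Finset.mem_biUnion]; exact ⟨C, hCJ, hz⟩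
      obtain ⟨hzU, -⟩ := comps_sub ends E₀ x Vf hC hz
      rcases hzU with hzK | hzKb
      · exact absurd ⟨hC, comps_subset_red ends E₀ x Vf hCC hC hz hzK⟩ hnot
      · exact Or.inr (Or.inr ⟨hzW, hzKb⟩)

end Coefficientwise

end Summit.CriticalPhenomena.PercolationContinuityZ3.Theorems
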